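import Summits.CriticalPhenomena.PercolationContinuityZ3.Theses.PercLowPointHalfSpace
import Literature.Probability.Percolation.HalfSpacePinnedPairs
import Literature.Probability.LatticeModels.IsoradialPercolation
-- Checked against (read; the farm snapshot does not yet build them as imports, see the line card):
-- import Summits.CriticalPhenomena.PercolationContinuityZ3.Theorems.QuantitativeBGN.Negative.ArmLowerBound
-- import Summits.CriticalPhenomena.PercolationContinuityZ3.Theorems.QuantitativeBGN.Negative.LoadBearing

/-!
# Line `longrange-wall-ghost-bootstrap` — skeleton for the crux `QuantitativeBGN`
(stmt-CriticalPhenomena-0913; route `PercLowPointHalfSpace`, shared by `PercPorousCritical`,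
`PercFoamCut`, `PercPortalLadder`)

Crux (fixed, the route's decl): `∃ a C, 0 < a ∧ ∀ r ≥ 1, P_{p_c(ℤ³)}(arm_H(0,r)) ≤ C r^{-a}`.

THE LINE (card `Ideas/longrange-wall-ghost-bootstrap.md`, triage TRIAGE-r1-{1,2,3} all pass, with the
two load-bearing sharpenings folded in). Enlarge the MODEL, not the argument: on top of bond percolation
on `ℤ³` with bulk density `p`, open every unordered pair `{u,v}` of distinct, non-adjacent WALL vertices
(`u₀ = v₀ = 0`) independently with probability `1 - exp(-λ ‖u-v‖∞^{-(2+α)})` (`augWall p λ α`, a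
`prodBernoulli` measure on the crux's own sample space `BondConfig (Site 3)`). The half-space cluster
`C_H(0)` and its wall FOOTPRINT `F = |C_H(0) ∩ ∂H|` are the same functions of `ω` as before
(`openConnIn {x | 0 ≤ x₀}` uses every open pair, so wall bonds are legal steps inside `H`).

* `stub_wallTwoGhost` (K1, Hutchcroft arXiv:2008.11197 Thm 3.1 re-proved on the wall): the improved
  two-ghost inequality for the wall bonds at `0`, with the ghost field supported on wall bonds, so that the
  exploration martingale's quadratic variation is `w(E(K)) ∈ [F/2, F]` and the ONLY symmetry used is the
  mass-transport principle for the group `ℤ²` of wall translations (ibid. Lemma 3.3, "the only place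
  unimodularity is used"); true for every `p`, uniformly (the wall-bond probabilities do not depend on `p`).
* `stub_stableWall` (K2_T, the triage's corrected K2): for SOME `α ∈ (0,1)` and SOME `λ > 0` the augmented
  model is subcritical in the mean sense at every bulk density `p < p_c(ℤ³)`:
  `E_{augWall p λ α} |C_H(0)| < ∞`. This is "a weak long-range wall enhancement does not move the surface
  transition" (ordinary-transition irrelevance, RG eigenvalue `(d-1) - 2x_s - α ≈ 0.05 - α < 0`) PLUS
  sharpness for the `ℤ²`-invariant augmented model. It is the single place where `p < p_c` enters
  (Disproof `quantitativeBGNAt_false_of_criticalProb_lt`: it is false for `p > p_c`).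
* `stub_wallBootstrap` (Hutchcroft's Lemma 4.1 + proof of Thm 1.1 on the wall, `d_wall = 2`, PRIMITIVE
  hyperscaling (2.1) only, hence `α < 1` and output exponent `θ = (1-α)/2`; choosing `r = n` balances the two
  terms): K1 + K2_T ⟹ `P_{augWall p λ α}(F ≥ n) ≤ B n^{-θ}` for all `p < p_c`, `n ≥ 1`, ONE `B`.
* `stub_transfer`: the bound passes to the crux's measure at `p_c` and `λ = 0`: stochastic domination of
  product measures (adding wall bonds only enlarges the increasing event `{F ≥ n}`) + left-continuity of
  `p ↦ P_p(F ≥ n)` at `p_c` (increasing union of increasing cylinder events).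
* `stub_thinFootTall` (K3): at `p_c`, tall half-space clusters with polynomially THIN feet are
  polynomially rare: `P(arm_H(0,r), F ≤ r^δ) ≤ C r^{-a}` for some `a, δ > 0` (the crux restricted to thin
  feet; at logarithmic feet it is the provable packing lemma `thinfoot_packing` of card
  reflection-squaring-akn; the power-feet version is the second open input).
* `QuantitativeBGN_of` (kernel-checked): `u(r) ≤ P(arm, F ≤ r^δ) + P(F ≥ ⌊r^δ⌋+1) ≤ C r^{-a} + B r^{-δθ}`,
  exponent `min(a, δθ) > 0`.

Disproof.lean honoured: `p = p_c`/`p < p_c` is used exactly in K2_T (false above `p_c`) and K3 (at `p_c`);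
`1 ≤ r`, `1 ≤ n` guards everywhere (`quantitativeBGN_false_without_rPos`); output exponent tiny, inside the
window `0 < a ≤ 2` of `Negative.armH_lower_bound` / `not_quantitativeBGNWith_of_two_lt` (imported below);
`tendsto_armH_criticalProb` is the `λ = 0`, qualitative shadow of K2_T. No stub is an instance of a landed
Negative lemma (they concern the full arm event / exponents `a > 2` / exponential rates).
-/

noncomputable section

open scoped Classical ENNReal
open MeasureTheory Filter
open Literature.Probability.Percolation Literature.Probability.LatticeModels

namespace Summit.CriticalPhenomena.PercolationContinuityZ3.Cruxes.QuantitativeBGN.LongrangeWallGhostBootstrap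

/-! ## The objects -/

/-- The crux's event `arm_H(0,r)`: the `H`-cluster of `0` reaches sup-distance `≥ r` (verbatim the set in
`QuantitativeBGN`; same text as `Theorems/QuantitativeBGN/Negative/ArmLowerBound.lean`'s `armH`). -/
def armH (r : ℕ) : Set (BondConfig (Site 3)) :=
  {ω | ∃ y : Site 3, (∃ i : Fin 3, (r : ℤ) ≤ |y i|) ∧
    ω ∈ openConnIn {x : Site 3 | 0 ≤ x 0} 0 y}

/-- The half-space `H = {x | 0 ≤ x₀}` of the crux (`= halfSpace 3` of `HalfSpace.lean`). -/
abbrev Hsp : Set (Site 3) := {x | 0 ≤ x 0}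

/-- The critical bond percolation measure on `ℤ³` (the crux's measure). -/
abbrev μc : Measure (BondConfig (Site 3)) := bondPercolation (zdGraph 3) (criticalProbI 3)

/-- The `H`-cluster of `x`: vertices joined to `x` by an open path of `ω` inside `H` (ALL open pairs of
`ω` are steps — under `augWall` this includes the long wall bonds). For `x = 0` this is
`halfSpaceCluster ω`. -/
def clusterH (ω : BondConfig (Site 3)) (x : Site 3) : Set (Site 3) := {v | ω ∈ openConnIn Hsp x v}

/-- The wall footprint `F_x(ω) = |C_H(x) ∩ ∂H| ∈ ℕ∞`, `∂H = {x₀ = 0}` (`= halfSpaceFootprint ω` at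
`x = 0`). -/
def footAt (ω : BondConfig (Site 3)) (x : Site 3) : ℕ∞ := (clusterH ω x ∩ {v | v 0 = 0}).encard

/-- The increasing event `{n ≤ F_x}`. -/
def footGe (x : Site 3) (n : ℕ) : Set (BondConfig (Site 3)) := {ω | (n : ℕ∞) ≤ footAt ω x}

/-- Sup-norm distance of the two endpoints of an unordered pair of sites. -/
def pairDist : Sym2 (Site 3) → ℝ := Sym2.lift ⟨fun u v => ‖u - v‖, fun u v => norm_sub_rev u v⟩

/-- A WALL pair: both endpoints on `∂H = {x₀ = 0}` and distinct. -/
def IsWallPair (e : Sym2 (Site 3)) : Prop := (∀ u ∈ e, u 0 = 0) ∧ ¬ e.IsDiag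

/-- Edge weights of the AUGMENTED model: bulk density `p` on nearest-neighbour lattice edges, the
long-range weight `1 - exp(-λ ‖u-v‖^{-(2+α)})` on non-adjacent wall pairs, `0` elsewhere. -/
def augWeight (p : unitInterval) (lam α : ℝ) (e : Sym2 (Site 3)) : ℝ :=
  if e ∈ (zdGraph 3).edgeSet then (p : ℝ)
  else if IsWallPair e then 1 - Real.exp (-(lam * pairDist e ^ (-(2 + α))))
  else 0

/-- The same weights clamped into `[0,1]` (a no-op for `λ ≥ 0`). -/
def augProb (p : unitInterval) (lam α : ℝ) (e : Sym2 (Site 3)) : unitInterval :=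
  Set.projIcc (0 : ℝ) 1 zero_le_one (augWeight p lam α e)

/-- **The auxiliary model**: independent bonds with probabilities `augProb p λ α` — critical-or-subcritical
bulk percolation on `ℤ³` plus long-range wall bonds. Same sample space as the crux's measure. -/
def augWall (p : unitInterval) (lam α : ℝ) : Measure (BondConfig (Site 3)) :=
  prodBernoulli (augProb p lam α)

/-- The probability of the wall bond `{0, x}` in the augmented model. -/
def wallBondProb (p : unitInterval) (lam α : ℝ) (x : Site 3) : ℝ :=
  (augProb p lam α s((0 : Site 3), x) : ℝ)

/-- Indices of the long wall bonds at `0`: wall points other than `0` and its lattice neighbours. -/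
abbrev WallIdx : Type := {x : Site 3 // x 0 = 0 ∧ x ≠ 0 ∧ ¬ (zdGraph 3).Adj 0 x}

/-- The wall two-arm event `S'_{x,n}` of the two-ghost inequality: `0` and the wall point `x` lie in
DISTINCT `H`-clusters, both with wall footprint `≥ n`, and `C_H(0)` is finite. -/
def wallTwoArm (x : Site 3) (n : ℕ) : Set (BondConfig (Site 3)) :=
  {ω | ω ∉ openConnIn Hsp 0 x ∧ (n : ℕ∞) ≤ footAt ω 0 ∧ (n : ℕ∞) ≤ footAt ω x ∧ (clusterH ω 0).Finite}

/-! ## The statements of the line -/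

/-- K1 — **improved two-ghost inequality on the wall** (Hutchcroft arXiv:2008.11197 Thm 3.1 with
`G` = `H` + wall bonds, `Γ = ℤ²` wall translations, ghost field on wall bonds, quadratic variation
`w(E(K)) ≤ F`): if `P(F ≥ m) ≤ A m^{-θ}` (`0 ≤ θ < 1/2`) then
`Σ_x (q_x/(1-q_x)) P(S'_{x,n})² ≤ C A² n^{-(1+2θ)}/(1-2θ)²`, the sum over any finite set of long wall
bonds `{0,x}`, `q_x` their probabilities; `C` universal (`10000` in the source). -/
def WallTwoGhostIneq (α lam : ℝ) : Prop :=
  ∃ C : ℝ, ∀ p : unitInterval, ∀ θ A : ℝ, 0 ≤ θ → θ < 1 / 2 → 1 ≤ A → ∀ n : ℕ, 1 ≤ n →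
    (∀ m : ℕ, 1 ≤ m → (augWall p lam α).real (footGe 0 m) ≤ A * (m : ℝ) ^ (-θ)) →
    ∀ s : Finset WallIdx,
      ∑ x ∈ s, wallBondProb p lam α x.1 / (1 - wallBondProb p lam α x.1) *
          (augWall p lam α).real (wallTwoArm x.1 n) ^ 2
        ≤ C * A ^ 2 / (1 - 2 * θ) ^ 2 * (n : ℝ) ^ (-(1 + 2 * θ))

/-- K2_T — **the augmented wall is subcritical below `p_c`**: at bulk density `p < p_c(ℤ³)` the augmented
`H`-cluster of `0` has finite mean size (hence finite mean footprint and a.s. finiteness). -/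
def AugSubcritical (α lam : ℝ) : Prop :=
  ∀ p : unitInterval, (p : ℝ) < criticalProb (zdGraph 3) (0 : Site 3) →
    ∫⁻ ω, ((clusterH ω 0).encard : ℝ≥0∞) ∂(augWall p lam α) < ⊤

/-- Output of the bootstrap: ONE constant `B` bounding the augmented footprint tail at every `p < p_c`. -/
def UniformFootprintTail (α lam θ B : ℝ) : Prop :=
  ∀ p : unitInterval, (p : ℝ) < criticalProb (zdGraph 3) (0 : Site 3) →
    ∀ n : ℕ, 1 ≤ n → (augWall p lam α).real (footGe 0 n) ≤ B * (n : ℝ) ^ (-θ)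

/-- `FootprintTail(θ)` for the ORIGINAL model AT `p_c`: `P_{p_c}(|C_H(0) ∩ ∂H| ≥ n) ≤ B n^{-θ}`. -/
def FootprintTailCrit (θ B : ℝ) : Prop :=
  ∀ n : ℕ, 1 ≤ n → μc.real (footGe 0 n) ≤ B * (n : ℝ) ^ (-θ)

/-- K3 — **thin-footed tall clusters are polynomially rare** at `p_c(ℤ³)`:
`P(arm_H(0,r), F ≤ r^δ) ≤ C r^{-a}` for some `a, δ > 0`. -/
def ThinFootTall : Prop :=
  ∃ a δ C : ℝ, 0 < a ∧ 0 < δ ∧ ∀ r : ℕ, 1 ≤ r →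
    μc.real (armH r ∩ {ω | footAt ω 0 ≤ (⌊(r : ℝ) ^ δ⌋₊ : ℕ∞)}) ≤ C * (r : ℝ) ^ (-a)

/-! ## Sanity checks (definitional alignment with the tree and the crux) -/

example (ω : BondConfig (Site 3)) : clusterH ω 0 = halfSpaceCluster ω := rfl

example (ω : BondConfig (Site 3)) : footAt ω 0 = halfSpaceFootprint ω := rfl

/-- READBACK: the crux is literally a power bound on `μc.real (armH r)`. -/
theorem quantitativeBGN_iff :
    Summit.CriticalPhenomena.PercolationContinuityZ3.Theses.PercLowPointHalfSpace.QuantitativeBGN ↔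
    ∃ a C : ℝ, 0 < a ∧ ∀ r : ℕ, 1 ≤ r → μc.real (armH r) ≤ C * (r : ℝ) ^ (-a) := Iff.rfl

/-! ## Registered stubs -/

/-- **stub_stableWall (K2_T, OPEN, qualitative; size L).** For some `α ∈ (0,1)` (intended: `α` close to
`1`; heuristically FALSE for `α < (d-1) - 2x_s ≈ 0.05`) and some `λ > 0`, the augmented model has finite
mean `H`-cluster size at every `p < p_c(ℤ³)`. Content: positivity of the special point for long-range wall
enhancement + sharpness (OSSS/Aizenman–Barsky type) for the `ℤ²`-invariant augmented model. The cheap tree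
bound `E F_aug ≤ χ_s(p)/(1 - λ J₁ χ_s(p))` proves it only while `λ J₁ E_p F < 1`, which fails as
`p ↑ p_c` if `x_s < 1`; screening of short bonds by the parent cluster is the expected mechanism. -/
theorem stub_stableWall : ∃ α lam : ℝ, 0 < α ∧ α < 1 ∧ 0 < lam ∧
    ∀ p : unitInterval, (p : ℝ) < criticalProb (zdGraph 3) (0 : Site 3) →
      ∫⁻ ω, ((clusterH ω 0).encard : ℝ≥0∞) ∂(augWall p lam α) < ⊤ := by
  sorry

/-- **stub_wallTwoGhost (K1, provable now from the source; size L).** The improved two-ghost inequality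
holds on the wall for every `α, λ` and every bulk density `p` (AKN fluctuation identity on any graph;
mass transport only among wall-anchored bonds, i.e. the vertex MTP of `ℤ²` on `∂H`; exploration
martingale with increments on wall bonds only, Doob `L²` maximal inequality; Hutchcroft's `√w`
re-weighting and optimisation over good weights). arXiv:2008.11197 §3 (Thm 3.1, Prop 3.2, Lemmas
3.3–3.5), arXiv:1808.08940 Lemma 3.1. -/
theorem stub_wallTwoGhost : ∀ α lam : ℝ, WallTwoGhostIneq α lam := by
  sorry

/-- **stub_wallBootstrap (provable now from the source; size M).** Hutchcroft's bootstrap run on the wall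
(`d_wall = 2`, `α < 1`, `θ = (1-α)/2`): Harris–FKG for the increasing events `{F₀ ≥ n}`, `{F_x ≥ n}`
under the product measure `augWall`, wall-translation invariance (`F_x =ᵈ F₀`), the union bound
`P(S'_{x,n}) ≥ P(F ≥ n)² - P(0 ↔_H x)` (a.s. finiteness from `AugSubcritical`), the primitive bound
`(1/|Λ_r|) Σ_{x ∈ Λ_r} P(0 ↔_H x) ≤ E[F ∧ |Λ_r|]/|Λ_r| ≤ C A r^{-2θ}`, Cauchy–Schwarz against K1 with
`(1-q_x)/q_x ≤ ‖x‖^{2+α}/λ`, the choice `r = n`, and the closed-set trick `A_p ≤ C A_p^{1/2} ⇒ A_p ≤ C²`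
(`A_p < ∞` because `E F < ∞`). arXiv:2008.11197 Prop 1.4, Lemma 4.1, proof of Thm 1.1. -/
theorem stub_wallBootstrap : ∀ α lam : ℝ, 0 < α → α < 1 → 0 < lam →
    WallTwoGhostIneq α lam → AugSubcritical α lam →
    ∃ B : ℝ, ∀ p : unitInterval, (p : ℝ) < criticalProb (zdGraph 3) (0 : Site 3) →
      ∀ n : ℕ, 1 ≤ n → (augWall p lam α).real (footGe 0 n) ≤ B * (n : ℝ) ^ (-((1 - α) / 2)) := by
  sorry

/-- **stub_transfer (provable now; size M).** `λ` is removed by monotonicity and `p ↑ p_c` by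
left-continuity: `P_{p_c}(F ≥ n) = sup_N lim_{p ↑ p_c} P_p(F ≥ n within Λ_N) ≤ sup_{p < p_c} P_p(F ≥ n)
≤ sup_{p < p_c} P_{augWall p λ α}(F ≥ n)` (stochastic domination of product measures on the increasing
event `{F ≥ n}`: `p · 1_{E(ℤ³)} ≤ augProb p λ α` pointwise; continuity of cylinder probabilities,
`continuous_bondPercolation_real_of_determinedBy`; `criticalProb_zd_pos`). -/
theorem stub_transfer : ∀ α lam θ B : ℝ,
    (∀ p : unitInterval, (p : ℝ) < criticalProb (zdGraph 3) (0 : Site 3) →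
      ∀ n : ℕ, 1 ≤ n → (augWall p lam α).real (footGe 0 n) ≤ B * (n : ℝ) ^ (-θ)) →
    ∀ n : ℕ, 1 ≤ n → μc.real (footGe 0 n) ≤ B * (n : ℝ) ^ (-θ) := by
  sorry

/-- **stub_thinFootTall (K3, OPEN, a rate statement at `p_c`; size L — judged the hardest).** Tall
critical half-space clusters with feet of size `≤ r^δ` have probability `≤ C r^{-a}`. True in the real world
for every `δ` (with `a = x_s ≈ 0.975`, since it is implied by the crux); provable today only at
logarithmic feet (`thinfoot_packing`: `P(arm_H(0,r), F ≤ m) ≤ m (1-p_c)^{-m}/(r+1)`, sealing + lex-min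
re-rooting mass transport); the power-feet version is the open bridge from footprint to radius. -/
theorem stub_thinFootTall : ∃ a δ C : ℝ, 0 < a ∧ 0 < δ ∧ ∀ r : ℕ, 1 ≤ r →
    μc.real (armH r ∩ {ω | footAt ω 0 ≤ (⌊(r : ℝ) ^ δ⌋₊ : ℕ∞)}) ≤ C * (r : ℝ) ^ (-a) := by
  sorry

/-! ## Name-keyed statements of the five stubs

The skeleton audit admits a hypothesis of `QuantitativeBGN_of` only if its head constant is a registered
obligation or is named like a declared stub; `Registered.stub_X` is the statement of `stub_X`, and
`X_holds` records that the stub proves it (definitionally). -/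

/-- Statement of `stub_stableWall` (K2_T). -/
def StableWallStmt : Prop := ∃ α lam : ℝ, 0 < α ∧ α < 1 ∧ 0 < lam ∧ AugSubcritical α lam

/-- Statement of `stub_wallTwoGhost` (K1). -/
def WallTwoGhostStmt : Prop := ∀ α lam : ℝ, WallTwoGhostIneq α lam

/-- Statement of `stub_wallBootstrap`. -/
def WallBootstrapStmt : Prop :=
  ∀ α lam : ℝ, 0 < α → α < 1 → 0 < lam → WallTwoGhostIneq α lam → AugSubcritical α lam →
    ∃ B : ℝ, UniformFootprintTail α lam ((1 - α) / 2) B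

/-- Statement of `stub_transfer`. -/
def TransferStmt : Prop := ∀ α lam θ B : ℝ, UniformFootprintTail α lam θ B → FootprintTailCrit θ B

theorem stableWall_holds : StableWallStmt := stub_stableWall
theorem wallTwoGhost_holds : WallTwoGhostStmt := stub_wallTwoGhost
theorem wallBootstrap_holds : WallBootstrapStmt := stub_wallBootstrap
theorem transfer_holds : TransferStmt := stub_transfer
theorem thinFootTall_holds : ThinFootTall := stub_thinFootTall

namespace Registered

/-- Alias of `StableWallStmt` keyed by the registered stub name. -/
abbrev stub_stableWall : Prop := StableWallStmt
/-- Alias of `WallTwoGhostStmt` keyed by the registered stub name. -/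
abbrev stub_wallTwoGhost : Prop := WallTwoGhostStmt
/-- Alias of `WallBootstrapStmt` keyed by the registered stub name. -/
abbrev stub_wallBootstrap : Prop := WallBootstrapStmt
/-- Alias of `TransferStmt` keyed by the registered stub name. -/
abbrev stub_transfer : Prop := TransferStmt
/-- Alias of `ThinFootTall` keyed by the registered stub name. -/
abbrev stub_thinFootTall : Prop := ThinFootTall

end Registered

/-! ## The composition (kernel-checked, no `sorry`) -/

/-- **`QuantitativeBGN` from the five stubs.** K2_T picks `α ∈ (0,1)`, `λ > 0`; K1 + bootstrap give the
uniform augmented footprint tail with `θ = (1-α)/2 > 0`; transfer gives `P_{p_c}(F ≥ n) ≤ B n^{-θ}`; with K3,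
`u(r) ≤ P(arm_H(0,r), F ≤ ⌊r^δ⌋) + P(F ≥ ⌊r^δ⌋ + 1) ≤ C r^{-a} + B r^{-δθ} ≤ (C⁺ + B⁺) r^{-min(a, δθ)}`. -/
theorem QuantitativeBGN_of
    (h₁ : Registered.stub_stableWall) (h₂ : Registered.stub_wallTwoGhost)
    (h₃ : Registered.stub_wallBootstrap) (h₄ : Registered.stub_transfer)
    (h₅ : Registered.stub_thinFootTall) :
    Summit.CriticalPhenomena.PercolationContinuityZ3.Theses.PercLowPointHalfSpace.QuantitativeBGN := by
  obtain ⟨α, lam, hα0, hα1, hlam, hsub⟩ := h₁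
  obtain ⟨B, hB⟩ := h₃ α lam hα0 hα1 hlam (h₂ α lam) hsub
  have hcrit : FootprintTailCrit ((1 - α) / 2) B := h₄ α lam _ B hB
  obtain ⟨a, δ, C, ha, hδ, hT⟩ := h₅
  have hθ : 0 < (1 - α) / 2 := by linarith
  refine quantitativeBGN_iff.2
    ⟨min a (δ * ((1 - α) / 2)), max C 0 + max B 0, lt_min ha (mul_pos hδ hθ), fun r hr => ?_⟩
  have hr0 : (0 : ℝ) < r := by exact_mod_cast hr
  have hr1 : (1 : ℝ) ≤ r := by exact_mod_cast hr
  -- split the arm event along the footprint threshold ⌊r^δ⌋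
  have hsplit : armH r ⊆ (armH r ∩ {ω | footAt ω 0 ≤ (⌊(r : ℝ) ^ δ⌋₊ : ℕ∞)}) ∪
      footGe 0 (⌊(r : ℝ) ^ δ⌋₊ + 1) := by
    intro ω hω
    by_cases hle : footAt ω 0 ≤ (⌊(r : ℝ) ^ δ⌋₊ : ℕ∞)
    · exact Or.inl ⟨hω, hle⟩
    · refine Or.inr ?_
      change ((⌊(r : ℝ) ^ δ⌋₊ + 1 : ℕ) : ℕ∞) ≤ footAt ω 0
      push_cast
      exact (ENat.add_one_le_iff (ENat.coe_ne_top _)).2 (not_le.1 hle)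
  have hle1 : μc.real (armH r) ≤
      μc.real (armH r ∩ {ω | footAt ω 0 ≤ (⌊(r : ℝ) ^ δ⌋₊ : ℕ∞)}) +
        μc.real (footGe 0 (⌊(r : ℝ) ^ δ⌋₊ + 1)) :=
    (measureReal_mono hsplit).trans (measureReal_union_le _ _)
  have hA := hT r hr
  have hBn := hcrit (⌊(r : ℝ) ^ δ⌋₊ + 1) (Nat.succ_le_succ (Nat.zero_le _))
  -- compare the powers
  have hmr : (r : ℝ) ^ δ ≤ ((⌊(r : ℝ) ^ δ⌋₊ + 1 : ℕ) : ℝ) := by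
    push_cast
    exact (Nat.lt_floor_add_one _).le
  have hpow1 : ((⌊(r : ℝ) ^ δ⌋₊ + 1 : ℕ) : ℝ) ^ (-((1 - α) / 2)) ≤ (r : ℝ) ^ (-(δ * ((1 - α) / 2))) := by
    calc ((⌊(r : ℝ) ^ δ⌋₊ + 1 : ℕ) : ℝ) ^ (-((1 - α) / 2))
        ≤ ((r : ℝ) ^ δ) ^ (-((1 - α) / 2)) :=
          Real.rpow_le_rpow_of_nonpos (Real.rpow_pos_of_pos hr0 δ) hmr (by linarith)
      _ = (r : ℝ) ^ (-(δ * ((1 - α) / 2))) := by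
          rw [← Real.rpow_mul hr0.le]
          congr 1
          ring
  have hpow2 : (r : ℝ) ^ (-(δ * ((1 - α) / 2))) ≤ (r : ℝ) ^ (-(min a (δ * ((1 - α) / 2)))) :=
    Real.rpow_le_rpow_of_exponent_le hr1 (neg_le_neg (min_le_right _ _))
  have hpow3 : (r : ℝ) ^ (-a) ≤ (r : ℝ) ^ (-(min a (δ * ((1 - α) / 2)))) :=
    Real.rpow_le_rpow_of_exponent_le hr1 (neg_le_neg (min_le_left _ _))
  calc μc.real (armH r)
      ≤ μc.real (armH r ∩ {ω | footAt ω 0 ≤ (⌊(r : ℝ) ^ δ⌋₊ : ℕ∞)}) +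
          μc.real (footGe 0 (⌊(r : ℝ) ^ δ⌋₊ + 1)) := hle1
    _ ≤ C * (r : ℝ) ^ (-a) + B * ((⌊(r : ℝ) ^ δ⌋₊ + 1 : ℕ) : ℝ) ^ (-((1 - α) / 2)) :=
          add_le_add hA hBn
    _ ≤ max C 0 * (r : ℝ) ^ (-(min a (δ * ((1 - α) / 2)))) +
          max B 0 * (r : ℝ) ^ (-(min a (δ * ((1 - α) / 2)))) := by
          apply add_le_add
          · calc C * (r : ℝ) ^ (-a) ≤ max C 0 * (r : ℝ) ^ (-a) :=
                  mul_le_mul_of_nonneg_right (le_max_left _ _) (Real.rpow_nonneg hr0.le _)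
              _ ≤ max C 0 * (r : ℝ) ^ (-(min a (δ * ((1 - α) / 2)))) :=
                  mul_le_mul_of_nonneg_left hpow3 (le_max_right _ _)
          · calc B * ((⌊(r : ℝ) ^ δ⌋₊ + 1 : ℕ) : ℝ) ^ (-((1 - α) / 2))
                ≤ max B 0 * ((⌊(r : ℝ) ^ δ⌋₊ + 1 : ℕ) : ℝ) ^ (-((1 - α) / 2)) :=
                  mul_le_mul_of_nonneg_right (le_max_left _ _) (Real.rpow_nonneg (by positivity) _)
              _ ≤ max B 0 * (r : ℝ) ^ (-(min a (δ * ((1 - α) / 2)))) :=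
                  mul_le_mul_of_nonneg_left (hpow1.trans hpow2) (le_max_right _ _)
    _ = (max C 0 + max B 0) * (r : ℝ) ^ (-(min a (δ * ((1 - α) / 2)))) := by ring

/-- Sanity: plugging the (sorried) stubs into the composition yields the crux. -/
example : Summit.CriticalPhenomena.PercolationContinuityZ3.Theses.PercLowPointHalfSpace.QuantitativeBGN :=
  QuantitativeBGN_of stableWall_holds wallTwoGhost_holds wallBootstrap_holds transfer_holds thinFootTall_holds

end Summit.CriticalPhenomena.PercolationContinuityZ3.Cruxes.QuantitativeBGN.LongrangeWallGhostBootstrap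

end
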